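/-
Origin: expansion seat `planner-pub-hodgecm-toy-g2-0`, handover #17 2026-08-18T08:14:40Z (`HOME/pub-hodgecm-toy-g2/lean/ToyG2/Good.lean`, md5 dd2b506d, 182 lines);
landed by the gen-7 packager in gate run 26 as `HodgeCM/Model/ToyG2/Good.lean` (import ^import ToyG2\.→import HodgeCM.Model.ToyG2. ×2).
-/
/-
# HodgeCM.Model.ToyG2.Good — good objects: every block has a nonzero trace of Hodge type (2,2)

Generation 2 of the `pub-hodgecm-toy` lineage (seat `planner-pub-hodgecm-toy-g2-0`), DESIGN.md §9.

`NoGysin.lean` shows that M26 fails on the full class `Obj₂` because blocks with zero (or badly typed)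
trace are admitted.  Here we single out the **good** objects — every block leaf `⟨O, ℓ⟩` has `ℓ ≠ 0` and
`ℓ` of Hodge type `(2,2)` (`ℓ_ℂ ∘ wt z = z² • ℓ_ℂ`) — and prove:

* `Obj₂.Good.prod`, `good_cmObj₂`, `good_pbObj` : closure properties;
* `baseC_comp_map`, `baseC_sum` : complexification of functionals commutes with pull-backs and sums;
* `isHodge_fstL`, `isHodge_sndL`, `isHodge_projFam` : the coordinate restrictions of `H¹(∏ Bₖ)` are
  Hodge maps;
* `isType22_pLeafOf` : the period functional `ℓ = ∑_q ℓ_{Θ_q} ∘ ⋀⁴ pr_q` of the period leaf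
  `P(L, ι₁)` has Hodge type `(2,2)` (from `EllType.baseC_ell_comp_wt` blockwise and the naturality
  `HodgeWeight.wt_comp_map`), hence `good_pLeafOf` : **the period leaves are good**.

The restricted universe on good objects is `Universe3.lean`.
-/
import Mathlib
import Summits.HodgeConjecture.HodgeCM.Model.ToyG2.EllType
import Summits.HodgeConjecture.HodgeCM.Model.ToyG2.NoGysin

namespace HodgeCM.ToyG2

open HodgeCM.Toy HodgeCM.Toy.CMPresentation exteriorPower Obj₂
open scoped TensorProduct
open Literature.AlgebraicGeometry.Motives
open Literature.AlgebraicGeometry.ShimuraVarieties (conjRingHomK)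

noncomputable section

/-! ### §1 Complexification commutes with pull-backs and sums -/

section BaseC

variable {X Y : Obj} {n : ℕ}

/-- `(φ ∘ ⋀ⁿψ)_ℂ = φ_ℂ ∘ ⋀ⁿ(ψ_ℂ)` -/
theorem baseC_comp_map (φ : (⋀[ℚ]^n Y.L) →ₗ[ℚ] ℚ) (ψ : X.L →ₗ[ℚ] Y.L) :
    baseC X (φ ∘ₗ map n ψ) = baseC Y φ ∘ₗ map n (ψ.baseChange ℂ) := by
  refine LinearMap.ext fun x => ?_
  obtain ⟨x', rfl⟩ := (X.Θ n).surjective x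
  have h2 : (Y.Θ n).symm (map n (ψ.baseChange ℂ) (X.Θ n x')) = (map n ψ).baseChange ℂ x' := by
    rw [LinearEquiv.symm_apply_eq]
    simp only [BC.thetaEquiv_apply]
    rw [BC.theta_naturality]
  simp only [baseC, LinearMap.coe_comp, Function.comp_apply, LinearEquiv.coe_coe,
    LinearEquiv.symm_apply_apply, h2, LinearMap.baseChange_comp]

variable (X) in
/-- (Ported verbatim from the HodgeCMPerL package; no docstring in the source.) -/
theorem baseC_add (φ ψ : (⋀[ℚ]^n X.L) →ₗ[ℚ] ℚ) : baseC X (φ + ψ) = baseC X φ + baseC X ψ := by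
  simp only [baseC, LinearMap.baseChange_add, LinearMap.add_comp, LinearMap.comp_add]

variable (X n) in
/-- `baseC` as an additive homomorphism in the functional -/
def baseCHom : ((⋀[ℚ]^n X.L) →ₗ[ℚ] ℚ) →+ ((⋀[ℂ]^n X.LC) →ₗ[ℂ] ℂ) :=
  AddMonoidHom.mk' (baseC X) (baseC_add X)

/-- (Ported verbatim from the HodgeCMPerL package; no docstring in the source.) -/
@[simp] lemma baseCHom_apply (φ : (⋀[ℚ]^n X.L) →ₗ[ℚ] ℚ) : baseCHom X n φ = baseC X φ := rfl

variable (X) in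
/-- (Ported verbatim from the HodgeCMPerL package; no docstring in the source.) -/
theorem baseC_sum {ι : Type*} (s : Finset ι) (φ : ι → ((⋀[ℚ]^n X.L) →ₗ[ℚ] ℚ)) :
    baseC X (∑ i ∈ s, φ i) = ∑ i ∈ s, baseC X (φ i) := by
  rw [← baseCHom_apply, map_sum]
  rfl

end BaseC

/-! ### §2 Coordinate restrictions are Hodge maps -/

section Hodge

/-- (Ported verbatim from the HodgeCMPerL package; no docstring in the source.) -/
lemma isHodge_fstL (A B : Obj) : Obj.IsHodge (X := A) (Y := A.prod B) (fstL A B) := by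
  have h : fstL A B = (Obj.lift (Obj.Hom.id A) ⟨0, isHodge_zero A B⟩).lin := by
    refine LinearMap.ext fun v => ?_
    simp [fstL, Obj.lift, Obj.Hom.id]
  rw [h]
  exact (Obj.lift _ _).hodge

/-- (Ported verbatim from the HodgeCMPerL package; no docstring in the source.) -/
lemma isHodge_sndL (A B : Obj) : Obj.IsHodge (X := B) (Y := A.prod B) (sndL A B) := by
  have h : sndL A B = (Obj.lift ⟨0, isHodge_zero B A⟩ (Obj.Hom.id B)).lin := by
    refine LinearMap.ext fun v => ?_
    simp [sndL, Obj.lift, Obj.Hom.id]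
  rw [h]
  exact (Obj.lift _ _).hodge

/-- (Ported verbatim from the HodgeCMPerL package; no docstring in the source.) -/
lemma isHodge_projFam : ∀ (m : ℕ) (B : Fin m → Obj) (k : Fin m),
    Obj.IsHodge (X := B k) (Y := prodFam m B) (projFam m B k)
  | 0, _, k => k.elim0
  | m + 1, B, k => by
      refine Fin.cases ?_ (fun k' => ?_) k
      · exact isHodge_fstL (B 0) (prodFam m fun k => B k.succ)
      · exact (isHodge_projFam m (fun k => B k.succ) k').comp
          (isHodge_sndL (B 0) (prodFam m fun k => B k.succ))

/-- the `k`-th coordinate restriction as a gen-1 morphism `Bₖ ⟶ ∏ B` -/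
def projHom (m : ℕ) (B : Fin m → Obj) (k : Fin m) : Obj.Hom (B k) (prodFam m B) :=
  ⟨projFam m B k, isHodge_projFam m B k⟩

/-- (Ported verbatim from the HodgeCMPerL package; no docstring in the source.) -/
@[simp] lemma projHom_lin (m : ℕ) (B : Fin m → Obj) (k : Fin m) :
    (projHom m B k).lin = projFam m B k := rfl

end Hodge

/-! ### §3 Hodge type (2,2) of a block trace; the period leaves -/

/-- the trace functional of a block has Hodge type `(2,2)`: `ℓ_ℂ ∘ wt z = z² • ℓ_ℂ` -/
def PLeaf.IsType22 (p : PLeaf) : Prop :=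
  ∀ z : ℂ, baseC p.O p.ℓ ∘ₗ p.O.wt z 4 = (z ^ 2) • baseC p.O p.ℓ

section leaf

variable (L : CMField) (ι₁ : L →+* ℂ)

/-- the block family `q ↦ M_{Θ_q}` as a lambda (reducibly equal to `blockFam`) -/
abbrev bfam : Fin (nQ L ι₁) → Obj := fun k => PP L (ΘOf L ι₁ k)

variable (d t : ℚ)

/-- blockwise: `(ℓ_{Θ_q} ∘ ⋀⁴ pr_q)_ℂ ∘ wt z = z² • (ℓ_{Θ_q} ∘ ⋀⁴ pr_q)_ℂ` on `∏_q M_{Θ_q}` -/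
theorem baseC_ell_proj_comp_wt (k : Fin (nQ L ι₁)) (z : ℂ) :
    baseC (prodFam (nQ L ι₁) (bfam L ι₁))
        (ellLin L (ΘOf L ι₁ k) (ξOf L ι₁ k) d t ∘ₗ map 4 (projFam (nQ L ι₁) (bfam L ι₁) k))
      ∘ₗ (prodFam (nQ L ι₁) (bfam L ι₁)).wt z 4
    = (z ^ 2) • baseC (prodFam (nQ L ι₁) (bfam L ι₁))
        (ellLin L (ΘOf L ι₁ k) (ξOf L ι₁ k) d t ∘ₗ map 4 (projFam (nQ L ι₁) (bfam L ι₁) k)) := by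
  rw [baseC_comp_map, LinearMap.comp_assoc, ← projHom_lin, ← Obj.wt_comp_map, ← LinearMap.comp_assoc,
    baseC_ell_comp_wt L (ΘOf L ι₁ k) d t (ξOf_conj L ι₁ k) (pairSum_ΘOf L ι₁ k) z,
    LinearMap.smul_comp]

/-- **the period functional of `P(L, ι₁)` has Hodge type (2,2)** -/
theorem isType22_pLeafOf : (pLeafOf L ι₁ d t).IsType22 := by
  intro z
  show baseC (prodFam (nQ L ι₁) (bfam L ι₁))
      (sumForm (nQ L ι₁) (bfam L ι₁) fun k => ellLin L (ΘOf L ι₁ k) (ξOf L ι₁ k) d t)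
      ∘ₗ (prodFam (nQ L ι₁) (bfam L ι₁)).wt z 4
    = (z ^ 2) • baseC (prodFam (nQ L ι₁) (bfam L ι₁))
      (sumForm (nQ L ι₁) (bfam L ι₁) fun k => ellLin L (ΘOf L ι₁ k) (ξOf L ι₁ k) d t)
  rw [sumForm, baseC_sum]
  refine LinearMap.ext fun x => ?_
  simp only [LinearMap.comp_apply, LinearMap.sum_apply, LinearMap.smul_apply, Finset.smul_sum]
  refine Finset.sum_congr rfl fun k _ => ?_
  have h := congrArg (fun φ => φ x) (baseC_ell_proj_comp_wt L ι₁ d t k z)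
  simpa only [LinearMap.comp_apply, LinearMap.smul_apply] using h

end leaf

/-! ### §4 Good leaves and good objects -/

/-- a leaf is **good**: an atom, or a block with nonzero trace of Hodge type `(2,2)` -/
def Leaf.Good : Leaf → Prop
  | .atom _ => True
  | .pb p => p.ℓ ≠ 0 ∧ p.IsType22

/-- an object is **good** if all its leaves are -/
def Obj₂.Good (X : Obj₂) : Prop := ∀ u, (X.leaf u).Good

/-- (Ported verbatim from the HodgeCMPerL package; no docstring in the source.) -/
lemma Obj₂.Good.prod {X Y : Obj₂} (hX : X.Good) (hY : Y.Good) : (X.prod Y).Good := by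
  rintro (u | u)
  · exact hX u
  · exact hY u

/-- (Ported verbatim from the HodgeCMPerL package; no docstring in the source.) -/
lemma good_cmObj₂ (K : CMField) (Φ : CMType K) : (cmObj₂ K Φ).Good := fun _ => trivial

/-- (Ported verbatim from the HodgeCMPerL package; no docstring in the source.) -/
lemma good_pbObj {p : PLeaf} (h : (Leaf.pb p).Good) : (pbObj p).Good := fun _ => h

/-- (Ported verbatim from the HodgeCMPerL package; no docstring in the source.) -/
lemma Leaf.Good.ℓ_ne_zero {p : PLeaf} (h : (Leaf.pb p).Good) : p.ℓ ≠ 0 := h.1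

/-- (Ported verbatim from the HodgeCMPerL package; no docstring in the source.) -/
lemma Leaf.Good.isType22 {p : PLeaf} (h : (Leaf.pb p).Good) : p.IsType22 := h.2

/-- the zero block is NOT good (this is the leaf used in `NoGysin`) -/
lemma not_good_zeroBlock (P : PLeaf) : ¬ (Leaf.pb (zeroBlock P)).Good := fun h => h.1 rfl

/-- **the period leaves are good** -/
theorem good_pLeafOf (L : CMField) (ι₁ : L →+* ℂ) (d t : ℚ) :
    (Leaf.pb (pLeafOf L ι₁ d t)).Good :=
  ⟨pLeafOf_ℓ_ne_zero L ι₁ d t, isType22_pLeafOf L ι₁ d t⟩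

end

end HodgeCM.ToyG2
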